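import Summits.RiemannHypothesis.RiemannHypothesis.Theorems.WeilGroundStateArchimedeanWindowSimpleEvenGapSound1
import HarnessLib

/-!
# `ArchimedeanWindowSimpleEven` — soundness of the gap certificate, II: the algebraic core

`core_nonneg_gap`: with both gap blocks checked and the constraint `Σ_j c_j y_j = 0` on the even
block, the reduced quadratic form plus `κ' ×` the Bessel expression is non-negative (the rank-one
term `λ|c·y|²` vanishes on the constraint hyperplane).

Route `RiemannHypothesis/WeilGroundState`, item `ArchimedeanWindowSimpleEven` (stmt-RiemannHypothesis-1529).
See `WeilGroundStateArchimedeanWindowSimpleEvenGapDefs.lean` for the certificate format, the data and the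
overall plan (LOWER bounds by the gap certificate `weilGapCert`, UPPER bound `ε((log 2)/2) ≤ 3/200` by the
trial function `trialFun`).
-/

namespace Summit.RiemannHypothesis.RiemannHypothesis.Theorems.WeilGroundState

open Literature.NumberTheory.LFunctions

namespace WeilGapCert

open Complex Finset MeasureTheory Set Filter
open scoped Real ComplexConjugate BigOperators

variable {c : WeilGapCert}

/-! ### The algebraic core of the gap certificate -/

/-- The rank-one form vanishes on the constraint hyperplane:
`Re Σ_{jj'} c_j c_{j'} conj(y_j) y_{j'} = ‖Σ_j c_j y_j‖² = 0`. [folklore] -/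
theorem rankOne_re_eq_zero (n : ℕ) (cv : ℕ → ℚ) (y : ℕ → ℂ)
    (hcon : ∑ j ∈ range n, (cv j : ℂ) * y j = 0) :
    (∑ j ∈ range n, ∑ j' ∈ range n, ((cv j * cv j' : ℚ) : ℂ) * (conj (y j) * y j')).re = 0 := by
  have h := WeilAna.norm_sq_sum_eq n (fun j ↦ (cv j : ℂ)) y
  rw [hcon, norm_zero, zero_pow two_ne_zero] at h
  rw [Complex.re_sum, h]
  refine Finset.sum_congr rfl fun j _ ↦ ?_
  rw [Complex.re_sum]
  refine Finset.sum_congr rfl fun j' _ ↦ ?_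
  rw [map_ratCast]
  push_cast
  ring_nf

/-- **The algebraic core.** With `N + 1 = 2 nb`, both gap blocks checked, and the constraint
`Σ_j c_j y_j(M) = 0` on the even block: the reduced form plus `κ' ×` the Bessel expression is
`Re y₀* S₀ y₀ − λ‖c·y₀‖² + Re y₁* S₁ y₁ ≥ 0`. [folklore] -/
theorem core_nonneg_gap (hN : c.base.N + 1 = 2 * c.base.nb) (hb0 : c.checkBlockG 0 = true)
    (hb1 : c.checkBlockG 1 = true) (a : ℝ) (ha : (c.base.a0 : ℝ) = a) (M : ℕ → ℂ)
    (hcon : ∑ j ∈ range c.base.nb, (getV c.cvec j : ℂ) * c.base.yVec M 0 j = 0) :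
    0 ≤ (∑ k ∈ range (c.base.N + 1), ∑ l ∈ range (c.base.N + 1),
        (c.base.prQ c.nu k l : ℝ) * (conj (M k) * M l).re) +
      (c.kappaG : ℝ) *
        (2 * (∑ k ∈ range (c.base.N + 1), conj (c.base.uVec M k) * M k).re -
          (∑ k ∈ range (c.base.N + 1), ∑ l ∈ range (c.base.N + 1),
            conj (c.base.uVec M k) * c.base.uVec M l * (gramH a k l : ℂ)).re) := by
  have hDC0 : c.base.checkDC 0 = true := by
    unfold checkBlockG at hb0; rw [Bool.and_eq_true] at hb0; exact hb0.1
  have hDC1 : c.base.checkDC 1 = true := by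
    unfold checkBlockG at hb1; rw [Bool.and_eq_true] at hb1; exact hb1.1
  -- rewrite everything as the real part of one complex expression
  have key : (∑ k ∈ range (c.base.N + 1), ∑ l ∈ range (c.base.N + 1),
        (c.base.prQ c.nu k l : ℝ) * (conj (M k) * M l).re) +
      (c.kappaG : ℝ) *
        (2 * (∑ k ∈ range (c.base.N + 1), conj (c.base.uVec M k) * M k).re -
          (∑ k ∈ range (c.base.N + 1), ∑ l ∈ range (c.base.N + 1),
            conj (c.base.uVec M k) * c.base.uVec M l * (gramH a k l : ℂ)).re) =
      ((∑ k ∈ range (c.base.N + 1), ∑ l ∈ range (c.base.N + 1),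
          (c.base.prQ c.nu k l : ℂ) * (conj (M k) * M l)) +
        (c.kappaG : ℂ) *
          (2 * ∑ k ∈ range (c.base.N + 1), conj (c.base.uVec M k) * M k -
            ∑ k ∈ range (c.base.N + 1), ∑ l ∈ range (c.base.N + 1),
              conj (c.base.uVec M k) * c.base.uVec M l * (gramH a k l : ℂ))).re := by
    have e1 : (∑ k ∈ range (c.base.N + 1), ∑ l ∈ range (c.base.N + 1),
        (c.base.prQ c.nu k l : ℂ) * (conj (M k) * M l)).re =
        ∑ k ∈ range (c.base.N + 1), ∑ l ∈ range (c.base.N + 1),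
          (c.base.prQ c.nu k l : ℝ) * (conj (M k) * M l).re := by
      rw [Complex.re_sum]
      refine Finset.sum_congr rfl fun k _ ↦ ?_
      rw [Complex.re_sum]
      refine Finset.sum_congr rfl fun l _ ↦ ?_
      rw [show ((c.base.prQ c.nu k l : ℚ) : ℂ) = (((c.base.prQ c.nu k l : ℚ) : ℝ) : ℂ) by norm_cast,
        Complex.re_ofReal_mul]
    have e2 : ∀ (κ : ℚ) (X Y : ℂ), ((κ : ℂ) * (2 * X - Y)).re = (κ : ℝ) * (2 * X.re - Y.re) := by
      intro κ X Y
      rw [show ((κ : ℚ) : ℂ) = (((κ : ℚ) : ℝ) : ℂ) by norm_cast, Complex.re_ofReal_mul]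
      congr 1
      simp [Complex.mul_re]
    rw [Complex.add_re, e1, e2]
  rw [key]
  -- parity split
  have hH : ∀ k l, k % 2 ≠ l % 2 → (gramH a k l : ℂ) = 0 := by
    intro k l hkl
    have hodd : Odd (k + l) := by
      rcases Nat.even_or_odd k with hk | hk <;> rcases Nat.even_or_odd l with hl | hl
      · exact absurd (by rw [Nat.even_iff.1 hk, Nat.even_iff.1 hl]) hkl
      · exact hk.add_odd hl
      · exact hk.add_even hl
      · exact absurd (by rw [Nat.odd_iff.1 hk, Nat.odd_iff.1 hl]) hkl
    rw [gramH, hodd.neg_one_pow]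
    simp
  rw [hN, WeilAlg.sum_sum_range_two_mul c.base.nb _ (fun k l hkl ↦ by
      rw [WeilCert.prQ_cross (c := c.base) c.nu hkl]; simp),
    WeilAlg.sum_range_two_mul c.base.nb,
    WeilAlg.sum_sum_range_two_mul c.base.nb _ (fun k l hkl ↦ by rw [hH k l hkl]; simp)]
  -- the Gram entries on the blocks
  have hG : ∀ p i i', p < 2 → (gramH a (2 * i + p) (2 * i' + p) : ℂ) = (c.base.hBlkQ p i i' : ℂ) := by
    intro p i i' hp
    have hev : Even (2 * i + p + (2 * i' + p)) := ⟨i + i' + p, by ring⟩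
    rw [gramH, hev.neg_one_pow, WeilCert.hBlkQ, ← ha]
    push_cast
    ring
  have e0 := block_identity_gap (c := c) (p := 0) (by norm_num) hDC0 M
  have e1 := block_identity_gap (c := c) (p := 1) (by norm_num) hDC1 M
  simp only [add_zero, if_true] at e0
  simp only [Nat.one_ne_zero, if_false, zero_mul, add_zero] at e1
  have hG0 : ∀ i i', (gramH a (2 * i) (2 * i') : ℂ) = (c.base.hBlkQ 0 i i' : ℂ) := fun i i' ↦ by
    simpa using hG 0 i i' (by norm_num)
  have hG1 : ∀ i i', (gramH a (2 * i + 1) (2 * i' + 1) : ℂ) = (c.base.hBlkQ 1 i i' : ℂ) := fun i i' ↦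
    hG 1 i i' (by norm_num)
  simp_rw [hG0, hG1]
  set CC : ℂ := ∑ j ∈ range c.base.nb, ∑ j' ∈ range c.base.nb,
    ((getV c.cvec j * getV c.cvec j' : ℚ) : ℂ) * (conj (c.base.yVec M 0 j) * c.base.yVec M 0 j') with hCC
  have etot : (∑ i ∈ range c.base.nb, ∑ j ∈ range c.base.nb,
        (c.base.prQ c.nu (2 * i) (2 * j) : ℂ) * (conj (M (2 * i)) * M (2 * j)) +
      ∑ i ∈ range c.base.nb, ∑ j ∈ range c.base.nb,
        (c.base.prQ c.nu (2 * i + 1) (2 * j + 1) : ℂ) * (conj (M (2 * i + 1)) * M (2 * j + 1))) +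
      (c.kappaG : ℂ) *
        (2 * (∑ i ∈ range c.base.nb, conj (c.base.uVec M (2 * i)) * M (2 * i) +
            ∑ i ∈ range c.base.nb, conj (c.base.uVec M (2 * i + 1)) * M (2 * i + 1)) -
          (∑ i ∈ range c.base.nb, ∑ j ∈ range c.base.nb,
              conj (c.base.uVec M (2 * i)) * c.base.uVec M (2 * j) * (c.base.hBlkQ 0 i j : ℂ) +
            ∑ i ∈ range c.base.nb, ∑ j ∈ range c.base.nb,
              conj (c.base.uVec M (2 * i + 1)) * c.base.uVec M (2 * j + 1) * (c.base.hBlkQ 1 i j : ℂ))) =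
      (∑ j ∈ range c.base.nb, ∑ j' ∈ range c.base.nb,
        (c.sgFun 0 j j' : ℂ) * (conj (c.base.yVec M 0 j) * c.base.yVec M 0 j') -
        (c.lam : ℂ) * CC) +
      ∑ j ∈ range c.base.nb, ∑ j' ∈ range c.base.nb,
        (c.sgFun 1 j j' : ℂ) * (conj (c.base.yVec M 1 j) * c.base.yVec M 1 j') := by
    rw [← e0, ← e1, hCC]
    ring
  rw [etot, Complex.add_re, Complex.sub_re]
  have hCCre : ((c.lam : ℂ) * CC).re = 0 := by
    rw [show ((c.lam : ℚ) : ℂ) = (((c.lam : ℚ) : ℝ) : ℂ) by norm_cast, Complex.re_ofReal_mul, hCC,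
      rankOne_re_eq_zero c.base.nb (fun j ↦ getV c.cvec j) (c.base.yVec M 0) hcon, mul_zero]
  rw [hCCre, sub_zero]
  exact add_nonneg
    (WeilAlg.re_herm_nonneg c.base.nb _ (fun x ↦ c.sgFun_quad_nonneg hb0 x) _)
    (WeilAlg.re_herm_nonneg c.base.nb _ (fun x ↦ c.sgFun_quad_nonneg hb1 x) _)

end WeilGapCert

end Summit.RiemannHypothesis.RiemannHypothesis.Theorems.WeilGroundState
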